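import Literature.Topology.FourManifolds.IndexOneOrthogonalPath
import Mathlib.Analysis.InnerProductSpace.PiL2
import HarnessLib

/-!
# Time-reversing Lorentz isometries of `ℝ³` of positive determinant are joined to the flip

Helper layer `helper_timelike_flipPath` (generic Lorentz linear algebra) of stub
`helper_foldNF_timelike` (the untwistedness of the round `1`-handle of a genus-one simplified
broken Lefschetz fibration), line `Sketch`, crux `SblfDescent.RungOne`.

(Crux item stmt-SmoothPoincare4-18531; skeleton `Cruxes/RungOne/Lines/Sketch.lean`.)

In the twisted alternative of the nappe dichotomy the monodromy `A` of a `2`-periodic adapted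
frame after one period is a `B`-isometry of the reference index-one form `B` (Lorentz frame
`(v₀, b₁, b₂)` of `ℝ³`) of positive determinant which REVERSES the time orientation,
`B (A v₀, v₀) > 0`.  We show (`helper_timelike_flipPath`) that such an `A` is joined, inside
`O(B)`, to the flip `F₀ : v₀ ↦ -v₀, b₁ ↦ b₁, b₂ ↦ -b₂` — which reverses the orientation of the
spacelike circle `cos θ b₁ + sin θ b₂` — by a continuous path (given through the inverses
`Ai s`, constant for `s ≤ 0` and `s ≥ 1`, with `Ai 0 = F₀` on the frame and `A ∘ Ai 1 = 1`):
`F₀ ∘ A` preserves the timecone and has positive determinant (`det F₀ = 1`), so O'Neill's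
connectedness of `SO⁺(1, 2)` in the tree's constructive form
(`IndexOneForm.exists_smooth_path_of_timeconePreserving`) joins it to the identity.

## References

* B. O'Neill, *Semi-Riemannian Geometry* (1983), Ch. 9, Lemma 6 and Cor. 7; Ch. 5, Lemma 29.
  [ONeill1983]
-/

set_option linter.dupNamespace false

noncomputable section

open scoped Topology ContDiff
open Set Function Filter Literature.Topology.FourManifolds

namespace Summit.SmoothPoincare4.SmoothPoincare4.Cruxes.RungOne.Sketch

/-- **The flip of a Lorentz frame of `ℝ³`.**  For a symmetric form `B` on `ℝ³` with Lorentz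
frame `(v₀, b₁, b₂)` there is a `B`-isometric involution `F₀` with `F₀ v₀ = -v₀`, `F₀ b₁ = b₁`,
`F₀ b₂ = -b₂` and `det F₀ = 1`. [folklore] -/
theorem exists_lorentzFlip {B : EuclideanSpace ℝ (Fin 3) →L[ℝ] EuclideanSpace ℝ (Fin 3) →L[ℝ] ℝ}
    (hB : ∀ x y, B x y = B y x) {v₀ b₁ b₂ : EuclideanSpace ℝ (Fin 3)}
    (hv : B v₀ v₀ = -1) (h1 : B b₁ b₁ = 1) (h2 : B b₂ b₂ = 1) (h01 : B v₀ b₁ = 0)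
    (h02 : B v₀ b₂ = 0) (h12 : B b₁ b₂ = 0)
    (hexp : ∀ x, x = (-B v₀ x) • v₀ + B b₁ x • b₁ + B b₂ x • b₂) :
    ∃ F₀ : EuclideanSpace ℝ (Fin 3) →L[ℝ] EuclideanSpace ℝ (Fin 3),
      F₀ v₀ = -v₀ ∧ F₀ b₁ = b₁ ∧ F₀ b₂ = -b₂ ∧ (∀ x, F₀ (F₀ x) = x) ∧
      (∀ x y, B (F₀ x) (F₀ y) = B x y) ∧ F₀.det = 1 := by
  have h10 : B b₁ v₀ = 0 := by rw [hB, h01]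
  have h20 : B b₂ v₀ = 0 := by rw [hB, h02]
  have h21 : B b₂ b₁ = 0 := by rw [hB, h12]
  -- the reflection `S : v₀ ↦ v₀, b₁ ↦ -b₁, b₂ ↦ b₂` and the flip `F₀ = -S`
  set S : EuclideanSpace ℝ (Fin 3) →L[ℝ] EuclideanSpace ℝ (Fin 3) :=
    (-(B v₀)).smulRight v₀ + (-(B b₁)).smulRight b₁ + (B b₂).smulRight b₂ with hSdef
  have hS : ∀ x, S x = (-B v₀ x) • v₀ + (-B b₁ x) • b₁ + B b₂ x • b₂ := fun x => by
    simp [hSdef]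
  have hSv : S v₀ = v₀ := by rw [hS, hv, h10, h20]; simp
  have hSb₁ : S b₁ = (-1 : ℝ) • b₁ + (0 : ℝ) • b₂ := by rw [hS, h01, h1, h21]; simp
  have hSb₂ : S b₂ = (0 : ℝ) • b₁ + (1 : ℝ) • b₂ := by rw [hS, h02, h12, h2]; simp
  have hSdet : S.det = -1 := by
    rw [IndexOneForm.det_eq_of_frame hB hv h1 h2 h01 h02 h12 hexp hSv hSb₁ hSb₂]; norm_num
  -- coordinates of `S x`
  have hcv : ∀ x, B v₀ (S x) = B v₀ x := fun x => by
    rw [hS]; simp only [map_add, map_smul, smul_eq_mul, hv, h01, h02]; ring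
  have hc1 : ∀ x, B b₁ (S x) = -B b₁ x := fun x => by
    rw [hS]; simp only [map_add, map_smul, smul_eq_mul, h10, h1, h12]; ring
  have hc2 : ∀ x, B b₂ (S x) = B b₂ x := fun x => by
    rw [hS]; simp only [map_add, map_smul, smul_eq_mul, h20, h21, h2]; ring
  have hSO : ∀ x y, B (S x) (S y) = B x y := fun x y => by
    rw [IndexOneForm.apply_eq_of_frame hexp (S x) (S y), IndexOneForm.apply_eq_of_frame hexp x y,
      hcv, hcv, hc1, hc1, hc2, hc2]
    ring
  have hSS : ∀ x, S (S x) = x := fun x => by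
    conv_rhs => rw [hexp x]
    rw [hS (S x), hcv, hc1, hc2, neg_neg]
  refine ⟨-S, ?_, ?_, ?_, fun x => ?_, fun x y => ?_, ?_⟩
  · change -(S v₀) = -v₀
    rw [hSv]
  · change -(S b₁) = b₁
    rw [hSb₁]; simp
  · change -(S b₂) = -b₂
    rw [hSb₂]; simp
  · change -(S (-(S x))) = x
    rw [map_neg, neg_neg, hSS]
  · change B (-(S x)) (-(S y)) = B x y
    rw [map_neg, map_neg, neg_apply, neg_neg, hSO]
  · have hneg : ((-S : EuclideanSpace ℝ (Fin 3) →L[ℝ] EuclideanSpace ℝ (Fin 3)) :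
        EuclideanSpace ℝ (Fin 3) →ₗ[ℝ] EuclideanSpace ℝ (Fin 3)) =
        (-1 : ℝ) • (S : EuclideanSpace ℝ (Fin 3) →ₗ[ℝ] EuclideanSpace ℝ (Fin 3)) := by
      rw [neg_one_smul]; rfl
    unfold ContinuousLinearMap.det
    rw [hneg, LinearMap.det_smul, finrank_euclideanSpace_fin]
    change (-1 : ℝ) ^ 3 * S.det = 1
    rw [hSdet]; norm_num

/-- **Time-reversing isometries of positive determinant are joined to the flip inside `O(B)`.**
Let `B` be a symmetric form on `ℝ³` with Lorentz frame `(v₀, b₁, b₂)` and `A ∈ O(B)` with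
`det A > 0` and `B (A v₀, v₀) > 0` (time-reversing).  Then there is a continuous family
`Ai : ℝ → O(B)`, constant for `s ≤ 0` and for `s ≥ 1`, with `Ai 0 b₁ = b₁`, `Ai 0 b₂ = -b₂`
(the flip) and `A ∘ Ai 1 = 1` (so `Ai 1 = A⁻¹`): the path `s ↦ (Ai s)⁻¹` joins the flip to `A`.
[cite: ONeill1983, Ch. 9, Lemma 6 and Cor. 7; Ch. 5, Lemma 29] -/
theorem helper_timelike_flipPath : ∀ (B : EuclideanSpace ℝ (Fin 3) →L[ℝ] EuclideanSpace ℝ (Fin 3) →L[ℝ] ℝ), (∀ x y, B x y = B y x) → ∀ (v₀ b₁ b₂ : EuclideanSpace ℝ (Fin 3)), B v₀ v₀ = -1 → B b₁ b₁ = 1 → B b₂ b₂ = 1 → B v₀ b₁ = 0 → B v₀ b₂ = 0 → B b₁ b₂ = 0 → (∀ x, x = (-B v₀ x) • v₀ + B b₁ x • b₁ + B b₂ x • b₂) → ∀ (A : EuclideanSpace ℝ (Fin 3) →L[ℝ] EuclideanSpace ℝ (Fin 3)), (∀ x y, B (A x) (A y) = B x y) → 0 < A.det → 0 < B (A v₀)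 v₀ → ∃ Ai : ℝ → (EuclideanSpace ℝ (Fin 3) →L[ℝ] EuclideanSpace ℝ (Fin 3)), Continuous Ai ∧ (∀ s x y, B (Ai s x) (Ai s y) = B x y) ∧ (∀ s : ℝ, s ≤ 0 → Ai s = Ai 0) ∧ (∀ s : ℝ, 1 ≤ s → Ai s = Ai 1) ∧ Ai 0 b₁ = b₁ ∧ Ai 0 b₂ = -b₂ ∧ (∀ y, A (Ai 1 y) = y) := by
  intro B hB v₀ b₁ b₂ hv h1 h2 h01 h02 h12 hexp A hAO hdet hrev
  obtain ⟨F₀, hF₀v, hF₀b₁, hF₀b₂, hF₀inv, hF₀O, hF₀det⟩ := exists_lorentzFlip hB hv h1 h2 h01 h02 h12 hexp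
  -- `R = F₀ ∘ A` preserves the timecone and has positive determinant
  set R : EuclideanSpace ℝ (Fin 3) →L[ℝ] EuclideanSpace ℝ (Fin 3) := F₀.comp A with hRdef
  have hRO : ∀ x y, B (R x) (R y) = B x y := fun x y => by
    change B (F₀ (A x)) (F₀ (A y)) = B x y
    rw [hF₀O, hAO]
  have hRdet : 0 < R.det := by
    have hmul : R.det = F₀.det * A.det := by
      unfold ContinuousLinearMap.det
      exact LinearMap.det_comp _ _
    rw [hmul, hF₀det, one_mul]
    exact hdet
  have hRcone : B (R v₀) v₀ < 0 := by
    change B (F₀ (A v₀)) v₀ < 0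
    have : B (F₀ (A v₀)) v₀ = B (A v₀) (F₀ v₀) := by
      have e : B (F₀ (A v₀)) v₀ = B (F₀ (A v₀)) (F₀ (F₀ v₀)) := by rw [hF₀inv]
      rw [e, hF₀O]
    rw [this, hF₀v, map_neg]
    linarith
  obtain ⟨P, Pinv, hPs, hPinvs, hP0, hP1, hPPi, hPiP, hPO⟩ :=
    IndexOneForm.exists_smooth_path_of_timeconePreserving hB hv h1 h2 h01 h02 h12 hexp hRO hRdet
      hRcone
  have hPinvO : ∀ s x y, B (Pinv s x) (Pinv s y) = B x y := fun s x y => by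
    conv_rhs => rw [← hPPi s x, ← hPPi s y]
    rw [hPO]
  -- uniqueness of the inverse along the constant ends
  have hPinv_eq : ∀ s s', P s = P s' → Pinv s = Pinv s' := fun s s' h =>
    ContinuousLinearMap.ext fun x => by
      have h2 : Pinv s x = Pinv s (P s' (Pinv s' x)) := by rw [hPPi]
      rw [h2, ← h, hPiP]
  refine ⟨fun s => (Pinv s).comp F₀, hPinvs.continuous.clm_comp continuous_const,
    fun s x y => ?_, fun s hs => ?_, fun s hs => ?_, ?_, ?_, fun y => ?_⟩
  · change B (Pinv s (F₀ x)) (Pinv s (F₀ y)) = B x y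
    rw [hPinvO, hF₀O]
  · change (Pinv s).comp F₀ = (Pinv 0).comp F₀
    rw [hPinv_eq s 0 (by rw [hP0 s hs, hP0 0 le_rfl])]
  · change (Pinv s).comp F₀ = (Pinv 1).comp F₀
    rw [hPinv_eq s 1 (by rw [hP1 s hs, hP1 1 le_rfl])]
  · change Pinv 0 (F₀ b₁) = b₁
    rw [hF₀b₁]
    have : Pinv 0 (P 0 b₁) = b₁ := hPiP 0 b₁
    rwa [hP0 0 le_rfl, ContinuousLinearMap.id_apply] at this
  · change Pinv 0 (F₀ b₂) = -b₂
    rw [hF₀b₂, map_neg]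
    have : Pinv 0 (P 0 b₂) = b₂ := hPiP 0 b₂
    rw [hP0 0 le_rfl, ContinuousLinearMap.id_apply] at this
    rw [this]
  · -- `A (Pinv 1 (F₀ y)) = y`: apply `F₀` to `P 1 (Pinv 1 (F₀ y)) = F₀ y`, `P 1 = F₀ ∘ A`
    change A (Pinv 1 (F₀ y)) = y
    have h := hPPi 1 (F₀ y)
    rw [hP1 1 le_rfl] at h
    change F₀ (A (Pinv 1 (F₀ y))) = F₀ y at h
    have := congrArg F₀ h
    rwa [hF₀inv, hF₀inv] at this

end Summit.SmoothPoincare4.SmoothPoincare4.Cruxes.RungOne.Sketch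

end
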